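import Mathlib
import HarnessLib

/-!
# Format C, design C∞ (L1): Fourier-type moments of monomials — `∫_a^b x^q e^{cx} dx` by parts

Route context: Fourier–Galerkin / Schur-complement certificates of Weil positivity on a window ("format C";
cell memo `run/shared/lean/pub/rh-explicit/rh-explicit-weil-10/FORMATC-DESIGN.md` §9.12.7–§9.12.8; supporting
stmt-RiemannHypothesis-0098; seat rh-explicit-weil-10).  The deflated certificate of design C∞ augments the Fourier block of the
window `[−a, a]` by the window POLYNOMIALS `x^q·1_{[−a,a]}`; their coordinates in Yoshida's basis `χ_m(x) = (2a)^{-1/2}e^{iω_m x}`,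
`ω_m = πm/a`, are the moments `∫_{−a}^{a} x^q e^{−iω_m x} dx`, i.e. finite expansions in `(−1)^m` and powers of `1/(πm)`.  This file
proves the elementary recursion that generates them (integration by parts) and the window specialisation.

* `integral_pow_succ_mul_cexp` — `∫_a^b x^{q+1} e^{cx} = (b^{q+1}e^{cb} − a^{q+1}e^{ca})/c − ((q+1)/c)·∫_a^b x^q e^{cx}` for `c ≠ 0`;
* `integral_pow_zero_mul_cexp` — the base case (`integral_exp_mul_complex`);
* `cexp_I_mul_freq_mul_self`, `cexp_I_mul_freq_mul_neg_self` — `e^{±iω_m a} = (−1)^m` for `ω_m = πm/a`, `a ≠ 0`;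
* `integral_window_pow_succ_mul_cexp` — the recursion on `[−a, a]` with `c = iω_m`: the boundary term is
  `(−1)^m (a^{q+1} − (−a)^{q+1})/(iω_m)`.
* `integral_pow_mul_cexp_eq_sum`, `integral_window_pow_mul_cexp_eq_sum` — the recursion solved: the closed forms
  `Σ_{k≤q} (−1)^k q^{(k)} (b^{q−k}e^{cb} − a^{q−k}e^{ca})/c^{k+1}` and, on the window, `(−1)^m Σ_{k≤q} (−1)^k q^{(k)} (a^{q−k} − (−a)^{q−k})/(iω_m)^{k+1}`.

Pure calculus; standard axioms; no RH claim.
-/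

-- `Summit.RiemannHypothesis.RiemannHypothesis.…` is the layout-mandated namespace (summit = problem name).
set_option linter.dupNamespace false

noncomputable section

open Complex MeasureTheory intervalIntegral
open scoped Real Interval

namespace Summit.RiemannHypothesis.RiemannHypothesis.Theorems.WeilFormatC

/-- The derivative of `x ↦ (x:ℂ)^(q+1)` along the real line. -/
theorem hasDerivAt_ofReal_pow_succ (q : ℕ) (x : ℝ) :
    HasDerivAt (fun y : ℝ ↦ ((y : ℂ)) ^ (q + 1)) (((q : ℂ) + 1) * (x : ℂ) ^ q) x := by
  have h1 : HasDerivAt (fun y : ℝ ↦ ((y : ℂ))) 1 x := by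
    simpa using (hasDerivAt_id (x : ℂ)).comp_ofReal
  have h2 := h1.pow (q + 1)
  simp only [Nat.add_sub_cancel, mul_one, Nat.cast_add, Nat.cast_one] at h2
  exact h2

/-- The derivative of `x ↦ e^{cx}/c` along the real line is `e^{cx}` (`c ≠ 0`). -/
theorem hasDerivAt_cexp_mul_div (c : ℂ) (hc : c ≠ 0) (x : ℝ) :
    HasDerivAt (fun y : ℝ ↦ Complex.exp (c * y) / c) (Complex.exp (c * x)) x := by
  have h1 : HasDerivAt (fun y : ℝ ↦ c * (y : ℂ)) c x := by
    simpa only [mul_one] using! ((hasDerivAt_id (x : ℂ)).const_mul c).comp_ofReal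
  have h2 : HasDerivAt (fun y : ℝ ↦ Complex.exp (c * (y : ℂ))) (Complex.exp (c * x) * c) x :=
    (Complex.hasDerivAt_exp _).comp x h1
  have h3 := h2.div_const c
  have h4 : Complex.exp (c * x) * c / c = Complex.exp (c * x) := by rw [mul_div_assoc, div_self hc, mul_one]
  rw [h4] at h3
  exact h3

/-- **Base case**: `∫_a^b x^0 e^{cx} dx = (e^{cb} − e^{ca})/c`. -/
theorem integral_pow_zero_mul_cexp {c : ℂ} (hc : c ≠ 0) (a b : ℝ) :
    ∫ x in a..b, ((x : ℂ)) ^ 0 * Complex.exp (c * x) = (Complex.exp (c * b) - Complex.exp (c * a)) / c := by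
  simp only [pow_zero, one_mul]
  exact integral_exp_mul_complex hc

/-- **Integration by parts for monomial × exponential**:
`∫_a^b x^{q+1} e^{cx} dx = (b^{q+1} e^{cb} − a^{q+1} e^{ca})/c − ((q+1)/c) ∫_a^b x^q e^{cx} dx` for `c ≠ 0`. -/
theorem integral_pow_succ_mul_cexp {c : ℂ} (hc : c ≠ 0) (q : ℕ) (a b : ℝ) :
    ∫ x in a..b, ((x : ℂ)) ^ (q + 1) * Complex.exp (c * x)
      = (((b : ℂ)) ^ (q + 1) * Complex.exp (c * b) - ((a : ℂ)) ^ (q + 1) * Complex.exp (c * a)) / c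
        - ((q : ℂ) + 1) / c * ∫ x in a..b, ((x : ℂ)) ^ q * Complex.exp (c * x) := by
  have hu : ∀ x ∈ [[a, b]], HasDerivAt (fun y : ℝ ↦ ((y : ℂ)) ^ (q + 1)) (((q : ℂ) + 1) * (x : ℂ) ^ q) x :=
    fun x _ ↦ hasDerivAt_ofReal_pow_succ q x
  have hv : ∀ x ∈ [[a, b]], HasDerivAt (fun y : ℝ ↦ Complex.exp (c * y) / c) (Complex.exp (c * x)) x :=
    fun x _ ↦ hasDerivAt_cexp_mul_div c hc x
  have hu' : IntervalIntegrable (fun x : ℝ ↦ ((q : ℂ) + 1) * (x : ℂ) ^ q) volume a b := by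
    apply Continuous.intervalIntegrable
    fun_prop
  have hv' : IntervalIntegrable (fun x : ℝ ↦ Complex.exp (c * x)) volume a b := by
    apply Continuous.intervalIntegrable
    fun_prop
  have key := integral_mul_deriv_eq_deriv_mul hu hv hu' hv'
  -- `key : ∫ u v' = u b v b − u a v a − ∫ u' v`
  rw [key]
  have e : ∫ x in a..b, ((q : ℂ) + 1) * (x : ℂ) ^ q * (Complex.exp (c * x) / c)
      = ((q : ℂ) + 1) / c * ∫ x in a..b, ((x : ℂ)) ^ q * Complex.exp (c * x) := by
    rw [← intervalIntegral.integral_const_mul]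
    refine intervalIntegral.integral_congr fun x _ ↦ ?_
    field_simp
  rw [e]
  field_simp

/-- On the window: `e^{iω_m a} = (−1)^m` for `ω_m = πm/a`, `a ≠ 0`. -/
theorem cexp_I_mul_freq_mul_self {a : ℝ} (ha : a ≠ 0) (m : ℤ) :
    Complex.exp (I * (π * m / a : ℝ) * a) = (-1 : ℂ) ^ m := by
  have ha' : (a : ℂ) ≠ 0 := by exact_mod_cast ha
  have h : (I * (π * m / a : ℝ) * a : ℂ) = (m : ℂ) * (π * I) := by
    push_cast
    field_simp
  rw [h, Complex.exp_int_mul, Complex.exp_pi_mul_I]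

/-- On the window: `e^{−iω_m a} = (−1)^m` as well. -/
theorem cexp_I_mul_freq_mul_neg_self {a : ℝ} (ha : a ≠ 0) (m : ℤ) :
    Complex.exp (I * (π * m / a : ℝ) * (((-a : ℝ)) : ℂ)) = (-1 : ℂ) ^ m := by
  have ha' : (a : ℂ) ≠ 0 := by exact_mod_cast ha
  have h : (I * (π * m / a : ℝ) * (((-a : ℝ)) : ℂ) : ℂ) = (-m : ℤ) * (π * I) := by
    push_cast
    field_simp
  rw [h, Complex.exp_int_mul, Complex.exp_pi_mul_I, zpow_neg, ← inv_zpow, inv_neg, inv_one]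

/-- **Window recursion**: with `c = iω_m`, `ω_m = πm/a` (`a ≠ 0`, `m ≠ 0`):
`∫_{−a}^{a} x^{q+1} e^{iω_m x} dx = (−1)^m (a^{q+1} − (−a)^{q+1})/(iω_m) − ((q+1)/(iω_m)) ∫_{−a}^{a} x^q e^{iω_m x} dx`. -/
theorem integral_window_pow_succ_mul_cexp {a : ℝ} (ha : a ≠ 0) {m : ℤ} (hm : m ≠ 0) (q : ℕ) :
    ∫ x in (-a)..a, ((x : ℂ)) ^ (q + 1) * Complex.exp (I * (π * m / a : ℝ) * x)
      = (-1 : ℂ) ^ m * (((a : ℂ)) ^ (q + 1) - (((-a : ℝ) : ℂ)) ^ (q + 1)) / (I * (π * m / a : ℝ))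
        - ((q : ℂ) + 1) / (I * (π * m / a : ℝ))
          * ∫ x in (-a)..a, ((x : ℂ)) ^ q * Complex.exp (I * (π * m / a : ℝ) * x) := by
  have hc : (I * (π * m / a : ℝ) : ℂ) ≠ 0 := by
    apply mul_ne_zero I_ne_zero
    exact_mod_cast (div_ne_zero (mul_ne_zero Real.pi_ne_zero (Int.cast_ne_zero.mpr hm)) ha)
  rw [integral_pow_succ_mul_cexp hc q (-a) a, cexp_I_mul_freq_mul_self ha m, cexp_I_mul_freq_mul_neg_self ha m]
  ring

/-! ## Closed form of the moments (the recursion solved) -/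

/-- **Closed form**: `∫_a^b x^q e^{cx} dx = Σ_{k=0}^{q} (−1)^k q^{(k)} (b^{q−k} e^{cb} − a^{q−k} e^{ca}) / c^{k+1}` for `c ≠ 0`,
`q^{(k)} = q!/(q−k)!` the descending factorial (the recursion `integral_pow_succ_mul_cexp` solved). -/
theorem integral_pow_mul_cexp_eq_sum {c : ℂ} (hc : c ≠ 0) (q : ℕ) (a b : ℝ) :
    ∫ x in a..b, ((x : ℂ)) ^ q * Complex.exp (c * x)
      = ∑ k ∈ Finset.range (q + 1), (-1 : ℂ) ^ k * (q.descFactorial k : ℂ)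
          * (((b : ℂ)) ^ (q - k) * Complex.exp (c * b) - ((a : ℂ)) ^ (q - k) * Complex.exp (c * a)) / c ^ (k + 1) := by
  induction q with
  | zero =>
    rw [integral_pow_zero_mul_cexp hc]
    simp
  | succ q ih =>
    rw [integral_pow_succ_mul_cexp hc q a b, ih, Finset.sum_range_succ' _ (q + 1)]
    simp only [Nat.succ_sub_succ_eq_sub, Nat.descFactorial_zero, Nat.sub_zero, pow_zero, one_mul, Nat.cast_one,
      zero_add, pow_one]
    rw [sub_eq_add_neg, add_comm, ← neg_mul, Finset.mul_sum]
    congr 1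
    refine Finset.sum_congr rfl fun k _ ↦ ?_
    rw [Nat.succ_descFactorial_succ]
    push_cast
    field_simp
    ring


/-- **Window closed form**: for `ω_m = πm/a` (`a ≠ 0`, `m ≠ 0`),
`∫_{−a}^{a} x^q e^{iω_m x} dx = (−1)^m Σ_{k=0}^{q} (−1)^k q^{(k)} (a^{q−k} − (−a)^{q−k}) / (iω_m)^{k+1}` — a finite expansion in
`(−1)^m` and the powers of `1/(πm)`; only the `k` with `q − k` odd survive. -/
theorem integral_window_pow_mul_cexp_eq_sum {a : ℝ} (ha : a ≠ 0) {m : ℤ} (hm : m ≠ 0) (q : ℕ) :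
    ∫ x in (-a)..a, ((x : ℂ)) ^ q * Complex.exp (I * (π * m / a : ℝ) * x)
      = (-1 : ℂ) ^ m * ∑ k ∈ Finset.range (q + 1), (-1 : ℂ) ^ k * (q.descFactorial k : ℂ)
          * (((a : ℂ)) ^ (q - k) - (((-a : ℝ) : ℂ)) ^ (q - k)) / (I * (π * m / a : ℝ)) ^ (k + 1) := by
  have hc : (I * (π * m / a : ℝ) : ℂ) ≠ 0 := by
    apply mul_ne_zero I_ne_zero
    exact_mod_cast (div_ne_zero (mul_ne_zero Real.pi_ne_zero (Int.cast_ne_zero.mpr hm)) ha)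
  rw [integral_pow_mul_cexp_eq_sum hc q (-a) a, cexp_I_mul_freq_mul_self ha m, cexp_I_mul_freq_mul_neg_self ha m,
    Finset.mul_sum]
  refine Finset.sum_congr rfl fun k _ ↦ ?_
  ring

end Summit.RiemannHypothesis.RiemannHypothesis.Theorems.WeilFormatC

end
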